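import Mathlib
import HarnessLib
import Summits.HubbardSuperconductivity.HubbardSuperconductivity.Theorems.KLProgrammeKLRegimeEngineTowerBlockIncrLevOrientedKitF
import Summits.HubbardSuperconductivity.HubbardSuperconductivity.Theorems.KLProgrammeKLRegimeEnginePartitionFnUnits

/-!
# Route `KLProgramme` — crux K3 ENGINE (stmt-HubbardSuperconductivity-20437 `KLRegimeEngineV17F2`), stub (b) v2, THE LEVELS PACKAGE (ℓ):
# «(ℓ)-Z-THREAD», model half — THE PARTITION FUNCTION OF THE TOWER'S FRAME PROPAGATES ALONG A BLOCK UNDER THE KIT GUARD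
# (located item #18 «(Z)-EXPORT», pen (R87), p5 g13 `Z-UNITS.md` §2; cell gate-hubbard-kl, seat hubbard-kl-k3c3-p2 g16)

The block step of the floor-keyed levelled law (`klLevNormOf_klTowerIncr_le_kit_orientedF9` / `klTowerBornLev_le_kit_orientedF9`, …TowerBlockIncrLevOrientedKitF;
`klTowerBLevF_succ_le_kitStep[_of_bounds]`, the LINK) needs `Z^K_{Λ_{dk}} ≠ 0` at the block's input scale.  With the SAME block data and the SAME kit guard it
hands to the oriented door, the step partition function `∫dμ_{Γ_k} e^{−𝒱_{dk}[K]}` is a unit (p5 g13 `isUnit_effPartitionFn_blockStep_lev`), so `Z^K_{Λ_{d(k+1)}} ≠ 0`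
(`hubbardEffPartitionFnCT_klScale_ne_zero_of_step`): this is the `hZsucc` input of the tokenised track induction `towerBorn_le_law_tracks_of_profile[_base]_tok`
(…TowerBookkeepingProfileTok) at `Zk k := (Z^K_{Λ_{dk}} ≠ 0)`.

* **`hubbardEffPartitionFnCT_klScale_block_succ_ne_zero_of_guard`** — block `k ≥ 1` of length `d ≥ 1`: `Z^K_{Λ_{dk}} ≠ 0`, the UNWEIGHTED block constants
  (Gram `κ` and rows/columns `α` of `S(F̃_{dk−1})ᵀ·C^K_{(Λ_{d(k+1)},Λ_{dk}]}·S(F̃_{dk−1})`, a radius `ρ`), a track-blind majorant `Nt ≥ 0`, `Nt 0 = 0`,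
  `ε·klTowerMeasLev … (2m) 0 ≤ Nt m`, a degree cap `D ≥ card/2`, `(e²(κ+ρ))² ≤ τ`, and the guard `e·α/κ²·towerV D τ Nt < 1` ⊢ `Z^K_{Λ_{d(k+1)}} ≠ 0`
  (the door's `θ < 1` is derived from the guard exactly as in KitF: `normV_mono` ∘ `normV_le_towerV` ∘ `towerV_mono`; the door's `hB` is
  `doorInput_klTowerInput_le_klTowerMeasLev`, evenness `klEffectiveAction_mem_evenPart`, `constPart = 0` from `Z^K_{Λ_{dk}} ≠ 0`).
* **`hubbardEffPartitionFnCT_klScale_block_succ_ne_zero_of_kitGuard`** — the same under KitF's literal guard `e·9α/κ²·towerV D τ Nt < 1`.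
Compositions of landed theorems; nothing about the model is asserted beyond them; nothing asserts (ℓ), any stub, K3 or superconductivity.
References: BGM 2006 §2.3 (2.13)–(2.14), §2.8 (2.76)–(2.84), §3 (3.2)–(3.8) [cite: BenfattoGiulianiMastropietro2006]; Salmhofer 1999 §2.5.1 (2.105)–(2.106) [cite: Salmhofer1999].
-/

noncomputable section

namespace Summit.HubbardSuperconductivity.HubbardSuperconductivity.Theorems.EngineV8

set_option linter.dupNamespace false -- summit = problem name (single-conjunct summit), D-0017

open Classical
open Real Finset Literature.MathematicalPhysics.QuantumLattice Literature.Probability.LatticeModels GrassmannAlgebra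
open Literature.MathematicalPhysics.QuantumLattice.FermiRG
open Summit.HubbardSuperconductivity.HubbardSuperconductivity.Theorems.KLProgrammeLegKernels
open Summit.HubbardSuperconductivity.HubbardSuperconductivity.Theorems.KLRegimeSplit
open Summit.HubbardSuperconductivity.HubbardSuperconductivity.Theorems.KLRegimeWick
open Summit.HubbardSuperconductivity.HubbardSuperconductivity.Theorems.DispersionFlow

variable {L M : ℕ} [NeZero L] [NeZero M]

/-- **`Z^K_{Λ_{dk}} ≠ 0` ⇒ `Z^K_{Λ_{d(k+1)}} ≠ 0` UNDER THE BLOCK DATA AND THE GUARD `e·α/κ²·towerV D τ Nt < 1`** (block `k ≥ 1`, length `d ≥ 1`; see the module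
docstring).  The majorant `Nt` is any track-blind array with `Nt 0 = 0` dominating the level-`0` measured sizes `ε·klTowerMeasLev … d k (2m) 0`; `D ≥ card/2`,
`(e²(κ+ρ))² ≤ τ`. [cite: BenfattoGiulianiMastropietro2006, §2.3 (2.13)-(2.14), §2.8 (2.76)-(2.84), §3 (3.2)-(3.8)] -/
theorem hubbardEffPartitionFnCT_klScale_block_succ_ne_zero_of_guard {β : ℝ} (hβ : 0 < β) (U μ : ℝ) (K : TrigPolyC4v) {d k : ℕ}
    (hd : 1 ≤ d) (hk : 1 ≤ k) (hZ : hubbardEffPartitionFnCT L M β U μ 0 K (klScale klE0 (d * k)) ≠ 0)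
    {κ : ℝ} (hκ : 0 < κ)
    (hGB : IsGramBoundedR ((sectorSubMatrix L M β (bgmFatMultiplier L M klE0 β (nambuXiCT L μ K) (d * k - 1))).transpose *
      hubbardCovSliceCT L M β μ 0 K (klScale klE0 (d * (k + 1))) (klScale klE0 (d * k)) *
        sectorSubMatrix L M β (bgmFatMultiplier L M klE0 β (nambuXiCT L μ K) (d * k - 1))) κ)
    {α : ℝ} (hα : 0 < α)
    (hrow : ∀ X, ∑ Y, ‖((sectorSubMatrix L M β (bgmFatMultiplier L M klE0 β (nambuXiCT L μ K) (d * k - 1))).transpose *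
        hubbardCovSliceCT L M β μ 0 K (klScale klE0 (d * (k + 1))) (klScale klE0 (d * k)) *
          sectorSubMatrix L M β (bgmFatMultiplier L M klE0 β (nambuXiCT L μ K) (d * k - 1))) X Y‖ ≤ α)
    (hcol : ∀ Y, ∑ X, ‖((sectorSubMatrix L M β (bgmFatMultiplier L M klE0 β (nambuXiCT L μ K) (d * k - 1))).transpose *
        hubbardCovSliceCT L M β μ 0 K (klScale klE0 (d * (k + 1))) (klScale klE0 (d * k)) *
          sectorSubMatrix L M β (bgmFatMultiplier L M klE0 β (nambuXiCT L μ K) (d * k - 1))) X Y‖ ≤ α)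
    {ρ : ℝ} (hρ : 0 < ρ)
    {Nt : ℕ → ℝ} (hNt0 : ∀ m, 0 ≤ Nt m) (hNt00 : Nt 0 = 0)
    (hNtB : ∀ m, imagTimeWeight β M * klTowerMeasLev L M β U μ K d k (2 * m) 0 ≤ Nt m)
    {D : ℕ} (hD : Fintype.card (SpaceTimeIdx L M × SectorLeg (sectorCount (d * k - 1))) / 2 ≤ D)
    {τ : ℝ} (hτ2 : (exp 2 * (κ + ρ)) ^ 2 ≤ τ)
    (hguard : exp 1 * α / κ ^ 2 * towerV D τ Nt < 1) :
    hubbardEffPartitionFnCT L M β U μ 0 K (klScale klE0 (d * (k + 1))) ≠ 0 := by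
  have hε : 0 ≤ imagTimeWeight β M := imagTimeWeight_nonneg hβ.le M
  have hτ0 : 0 ≤ τ := le_trans (by positivity) hτ2
  have hJ₁ : 1 ≤ d * k := hk.trans (Nat.le_mul_of_pos_left k hd)
  have hJ : d * k ≤ d * (k + 1) := Nat.mul_le_mul_left d (Nat.le_succ k)
  -- the door's `θ < 1` from the guard (as in …TowerBlockIncrLevOrientedKitF)
  have hB0 : ∀ m c, 0 ≤ (fun m c : ℕ => klTowerMeasLev L M β U μ K d k (2 * m) c) m c := fun m c =>
    klTowerMeasLev_nonneg hβ.le U μ K d k _ _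
  have h1 : ∀ m', (27 : ℝ) ^ 0 * (imagTimeWeight β M * klTowerMeasLev L M β U μ K d k (2 * m') 0) ≤ Nt m' := fun m' => by
    rw [pow_zero, one_mul]; exact hNtB m'
  have hnV : normV (SpaceTimeIdx L M × SectorLeg (sectorCount (d * k - 1))) κ ρ
      (fun m' => (27 : ℝ) ^ 0 * (imagTimeWeight β M * klTowerMeasLev L M β U μ K d k (2 * m') 0)) ≤ towerV D τ Nt :=
    (normV_mono hκ.le hρ.le h1).trans
      ((normV_le_towerV hκ.le hρ.le hNt0 hNt00 hD).trans (towerV_mono (by positivity) hτ2 hNt0 fun _ => le_rfl))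
  have hθ : Real.exp 1 * α * normV (SpaceTimeIdx L M × SectorLeg (sectorCount (d * k - 1))) κ ρ
      (fun m' => (27 : ℝ) ^ 0 * (imagTimeWeight β M * klTowerMeasLev L M β U μ K d k (2 * m') 0)) / κ ^ 2 < 1 := by
    calc Real.exp 1 * α * normV (SpaceTimeIdx L M × SectorLeg (sectorCount (d * k - 1))) κ ρ
          (fun m' => (27 : ℝ) ^ 0 * (imagTimeWeight β M * klTowerMeasLev L M β U μ K d k (2 * m') 0)) / κ ^ 2
        = exp 1 * α / κ ^ 2 * normV (SpaceTimeIdx L M × SectorLeg (sectorCount (d * k - 1))) κ ρ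
            (fun m' => (27 : ℝ) ^ 0 * (imagTimeWeight β M * klTowerMeasLev L M β U μ K d k (2 * m') 0)) := by ring
      _ ≤ exp 1 * α / κ ^ 2 * towerV D τ Nt := mul_le_mul_of_nonneg_left hnV (by positivity)
      _ < 1 := hguard
  -- the step partition function is a unit (p5 g13), hence the partition function at the next boundary
  have hunit := isUnit_effPartitionFn_blockStep_lev (L := L) (M := M) hβ μ K (J₁ := d * k) (J₂ := d * (k + 1)) hJ₁ hJ
    (klTowerInput L M β U μ K d k) (klEffectiveAction_mem_evenPart hβ.ne' U μ K klE0 (d * k))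
    (constPart_klEffectiveAction_eq_zero β U μ K klE0 (d * k) hZ) hκ hGB
    (fun m c : ℕ => klTowerMeasLev L M β U μ K d k (2 * m) c) hB0
    (fun m' Fc E τ' q hq hE y => doorInput_klTowerInput_le_klTowerMeasLev hβ.le U μ K d k m' Fc E τ' q hq hE y) hα hrow hcol hρ hθ
  exact hubbardEffPartitionFnCT_klScale_ne_zero_of_step β U μ K (d * (k + 1)) hZ hunit

/-- **The same under KitF's literal kit guard `e·9α/κ²·towerV D τ Nt < 1`** (the guard handed to `klLevNormOf_klTowerIncr_le_kit_orientedF9` /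
`klTowerBornLev_le_kit_orientedF9`): `Z^K_{Λ_{dk}} ≠ 0 ⇒ Z^K_{Λ_{d(k+1)}} ≠ 0`. [cite: BenfattoGiulianiMastropietro2006, §2.3 (2.13)-(2.14), §3 (3.2)-(3.8)] -/
theorem hubbardEffPartitionFnCT_klScale_block_succ_ne_zero_of_kitGuard {β : ℝ} (hβ : 0 < β) (U μ : ℝ) (K : TrigPolyC4v) {d k : ℕ}
    (hd : 1 ≤ d) (hk : 1 ≤ k) (hZ : hubbardEffPartitionFnCT L M β U μ 0 K (klScale klE0 (d * k)) ≠ 0)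
    {κ : ℝ} (hκ : 0 < κ)
    (hGB : IsGramBoundedR ((sectorSubMatrix L M β (bgmFatMultiplier L M klE0 β (nambuXiCT L μ K) (d * k - 1))).transpose *
      hubbardCovSliceCT L M β μ 0 K (klScale klE0 (d * (k + 1))) (klScale klE0 (d * k)) *
        sectorSubMatrix L M β (bgmFatMultiplier L M klE0 β (nambuXiCT L μ K) (d * k - 1))) κ)
    {α : ℝ} (hα : 0 < α)
    (hrow : ∀ X, ∑ Y, ‖((sectorSubMatrix L M β (bgmFatMultiplier L M klE0 β (nambuXiCT L μ K) (d * k - 1))).transpose *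
        hubbardCovSliceCT L M β μ 0 K (klScale klE0 (d * (k + 1))) (klScale klE0 (d * k)) *
          sectorSubMatrix L M β (bgmFatMultiplier L M klE0 β (nambuXiCT L μ K) (d * k - 1))) X Y‖ ≤ α)
    (hcol : ∀ Y, ∑ X, ‖((sectorSubMatrix L M β (bgmFatMultiplier L M klE0 β (nambuXiCT L μ K) (d * k - 1))).transpose *
        hubbardCovSliceCT L M β μ 0 K (klScale klE0 (d * (k + 1))) (klScale klE0 (d * k)) *
          sectorSubMatrix L M β (bgmFatMultiplier L M klE0 β (nambuXiCT L μ K) (d * k - 1))) X Y‖ ≤ α)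
    {ρ : ℝ} (hρ : 0 < ρ)
    {Nt : ℕ → ℝ} (hNt0 : ∀ m, 0 ≤ Nt m) (hNt00 : Nt 0 = 0)
    (hNtB : ∀ m, imagTimeWeight β M * klTowerMeasLev L M β U μ K d k (2 * m) 0 ≤ Nt m)
    {D : ℕ} (hD : Fintype.card (SpaceTimeIdx L M × SectorLeg (sectorCount (d * k - 1))) / 2 ≤ D)
    {τ : ℝ} (hτ2 : (exp 2 * (κ + ρ)) ^ 2 ≤ τ)
    (hguard : exp 1 * (9 * α) / κ ^ 2 * towerV D τ Nt < 1) :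
    hubbardEffPartitionFnCT L M β U μ 0 K (klScale klE0 (d * (k + 1))) ≠ 0 := by
  have hτ0 : 0 ≤ τ := le_trans (by positivity) hτ2
  have hV0 : 0 ≤ towerV D τ Nt := towerV_nonneg (D := D) hτ0 hNt0
  refine hubbardEffPartitionFnCT_klScale_block_succ_ne_zero_of_guard hβ U μ K hd hk hZ hκ hGB hα hrow hcol hρ hNt0 hNt00 hNtB hD hτ2 ?_
  calc exp 1 * α / κ ^ 2 * towerV D τ Nt ≤ exp 1 * (9 * α) / κ ^ 2 * towerV D τ Nt := by
        refine mul_le_mul_of_nonneg_right ?_ hV0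
        exact div_le_div_of_nonneg_right (mul_le_mul_of_nonneg_left (by linarith) (exp_pos 1).le) (sq_nonneg κ)
    _ < 1 := hguard

end Summit.HubbardSuperconductivity.HubbardSuperconductivity.Theorems.EngineV8

end
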